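/-
Copyright (c) 2026 the pub-hodgecm-mathlib formalisation cell (harness21).  Prover seat hodgecm-mathlib-K2Liu-p05 (g8), Track B «K2-LIT»,
#184♮ = hLiu418 = `stmt-HodgeConjecture-24832`; #42F′ FACE-G organ F4 (G-gen), B3-b §2 LETTER FILE (LEAD F0P6-plan (g14) BATCH #140 (1);
F4 lead K2Liu-p27 (g2) DESIGN OF RECORD 2026-09-04T23:26:22Z «(T2) + the (deriv-closure) letter»; consumer = R90-C10-p03 (g0)'s assembly
`K2LiuArchSWDataInduction` over ★ p863061 `K2LiuArchSWDataInductionCore.forall_tuple_of_fockLetters`).  THEOREMS ONLY (no `def`, no `instance`,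
no notation, no local instance, no named-fact hypothesis, no `sorry`);
lane `--supports stmt-HodgeConjecture-24832 --as helper`.
-/
import Summits.HodgeConjecture.HodgeConjecture.Theorems.K2LiuFockPActionExport         -- ★ (E-b) FILE 2: the `𝔭^±` symbols `Ap ∕ Am` as explicit terms, `binvPi_ap ∕ binvPi_am`, `hypOpGenC`
import Summits.HodgeConjecture.HodgeConjecture.Theorems.K2LiuU22AdaptedBasisDefs       -- ★ (G2-W1): `boostGen p q ∈ 𝔲(2,2)`, `exp (s · Y_{pq}) = hypV p q s`
import Literature.RepresentationTheory.KonnoKonno2007.JunctionPMinusWeilDatum          -- ★ `weilDatum_apply_rotBoost`, `κ_mul_inl_mul_κ_inv`, `rotBoostGen_binvPi`, `weilDatum_apply_hypV_eq_hypOp`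
import Literature.RepresentationTheory.KonnoKonno2007.JunctionWeilDatumGeneralRank     -- ★ the hypothesis-free junction datum `weilRep ∘ toBig`, `isArchWeilDatum_weilRepPair`
import Literature.Analysis.SegalBargmann.SchwartzIsotypicFockPolynomials               -- ★ `binvPi_injective`
import HarnessLib

/-!
# Crux `HLiu418`, FACE-G organ F4 (G-gen), B3-b §2 letter file (T2): THE TWO REAL LETTERS OF A ROOT `(p,q)` OF `𝔲(2,2)` ARE WEAK DERIVATIVE
# LETTERS OF EVERY ARCHIMEDEAN WEIL DATUM, AND THEIR `𝔭^±` COMBINATIONS ON FOCK DATA ARE THE (E-b) SYMBOLS `Ap ∕ Am`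

Cell `hodgecm-mathlib`, crux item hLiu418 = `stmt-HodgeConjecture-24832`; squad K2 ∕ K2Liu; prover K2Liu-p05 (g8) (first pen, LEAD BATCH #140 (1)),
F4 lead K2Liu-p27 (g2), desk K2Liu-p10 (g6), box K2E5-r02 (g6).

WHY (F4 design of record, K2Liu-p27 (g2) 2026-09-04T23:26:22Z ∕ 23:27:40Z).  B3 `K2LiuArchSWDataInduction` = FACE-G's third organ letter `hGgen` (★ p862960
`K2LiuFaceGAssembler.faceG_of_organs`) is ★ B3-core `forall_tuple_of_fockLetters` (★ p863061) ∘ ★ (E-f) `K2LiuLocalThetaCyclicUniform.induction_on_kFinite_fun`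
on POLYNOMIAL-SLOT TUPLES: at each real place `σ` the slot datum is a Fock polynomial `F : 𝒫_σ = MvPolynomial (DPIdx (Fin 2) (Fin 2) R S) ℂ` (junction of
`U(𝔻_σ) × U(V′_σ) = U(2,2) × U(R,S)`), `B := LinearMap.id`, `ωp := Ap`, `ωm := Am` (the ★ (E-b) FILE 2 symbols).  The assembly's remaining letters are the
(deriv-closure) clauses **`hAp_good : Good (update rest σ F) → Good (update rest σ (Ap σ i F))`**, `hAm_good`, to be paid from hGgen's (deriv) clause —
an `HasArchDeriv` statement along ONE REAL one-parameter orbit `archExp hX` of the small group — plus (add)(smul).  The complex root vector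
`𝔭⁺_{(p,q)} = X_v − i·X_{iv}` is a combination of TWO REAL directions: the boost `X_v = Y_{pq}` (`exp (s Y_{pq}) = hypV p q s`, ★ (G2-W1)
`exp_smul_boostGen`) and its conjugate `X_{iv} = Ad(k_P(θ)) Y_{pq}` by the phase element `k_P(θ) ∈ K` at `θ = π∕2` (★ Konno–Konno `phaseP`), acting on
Schwartz space by Konno–Konno's `hypOpGen` resp. `rotBoostGen θ = μ₀(D_θ) ∘ hypOpGen ∘ μ₀(D_θ)⁻¹` (★ `pPlus_binvPi`∕`pMinus_binvPi`: `𝔭^± ↔ hypOpGen ∓ i·rotBoostGen (π∕2)`).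
THIS FILE supplies the two (T2) letters WITHOUT any matrix identification of `rotBoostGen` with an adapted-basis direction: each real direction is read as a
WEAK DERIVATIVE LETTER `hD : ∀ T, HasDerivAt (s ↦ T (ω (exp (sY), 1) Φ)) (T D) 0` along its OWN one-parameter group, straight from the Literature
(★ `weilDatum_apply_hypV_eq_hypOp`, ★ `JunctionPMinusWeilDatum.weilDatum_apply_rotBoost`, ★ `isSmoothOneParam_hypOp`) — the shape consumed by the
section-level transport `K2LiuArchSWPlaceTransportSection` (sequel, this seat) and produced for a GENERAL `Y` by ★ (G2-W2) `hasDerivAt_weilDatum_expMem_smul'`.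
* §1 **`expMem_smul_boostGen`**, **`expMem_smul_conj_boostGen`** — `exp (s·Y_{pq}) = hypV p q s` and `exp (s·(g Y_{pq} g⁻¹)) = g (hypV p q s) g⁻¹` in `U(2,2)`
  (★ `exp_smul_boostGen`, Mathlib `Matrix.exp_units_conj`);
* §2 (T2-an) for EVERY archimedean Weil datum `ω` of `U(2,2) × U(R,S)` (★ `IsArchWeilDatum`, no vacuum clause needed), every continuous real-linear `T : 𝓢 → V`,
  every `Φ ∈ 𝓢`: **`hasDerivAt_weilDatum_expMem_boost`** — `HasDerivAt (s ↦ T (ω (exp (s Y_{pq}), 1) Φ)) (T (hypOpGenC p q Φ)) 0`;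
  **`hasDerivAt_weilDatum_expMem_conj_boost`** — along `Y := Ad((κ k_P(θ)).1) Y_{pq}`: `HasDerivAt (…) (T (μ₀(D_θ) (hypOpGenC p q (μ₀(D_θ)⁻¹ Φ)))) 0`
  (`= T (rotBoostGen θ Φ)`, ★ `rotBoostGen_apply`); the instances `…_weilRepPair` at the hypothesis-free junction datum `weilRep ∘ toBig` (★ `isArchWeilDatum_weilRepPair`)
  in the LITERAL `hD` shape of the sequel;
* §3 (T2-alg) the Fock reading: **`exists_fock_hypOpGenC`**, **`exists_fock_rotBoostGen`** (the derivative of `B⁻¹F` along either letter is again `B⁻¹G`, EXPLICIT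
  `G` from ★ `hypOpGen_binvPi` ∕ ★ `rotBoostGen_binvPi`); **`ap_eq_of_binvPi_eq`**, **`am_eq_of_binvPi_eq`** (`Ap_{(p,q)} F = G₁ − i·G₂`, `Am_{(p,q)} F = G₁ + i·G₂`
  whenever `B⁻¹G₁ = hypOpGen (B⁻¹F)`, `B⁻¹G₂ = rotBoostGen (π∕2) (B⁻¹F)`; ★ `binvPi_ap∕_am` + ★ `binvPi_injective`); and THE (deriv-closure) BOOKKEEPING
  **`good_ap_am_of_derivLetters`**: for ANY `Good₁ : 𝒫_σ → Prop` closed under `+` and scalars, `(∃ c G, B⁻¹G = hypOpGen (B⁻¹F) ∧ Good₁ (c • F + G)) →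
  (∃ c G, B⁻¹G = rotBoostGen (π∕2) (B⁻¹F) ∧ Good₁ (c • F + G)) → Good₁ F → Good₁ (Ap F) ∧ Good₁ (Am F)` — so the consumer's `hAp_good ∕ hAm_good` per
  `(σ, rest, i, F)` is: [sequel's Fock transport at the two §2 letters + hGgen (deriv)] ⇒ the two `∃ c G` clauses ⇒ this lemma.
NOT HERE: the section-level transport along `swSectionTensor` (sequel `K2LiuArchSWPlaceTransportSection`); the curve identity `archExp hX s = archEmb (ψ (exp sY))`
(★ `exists_archSkew_archExp_eq_placeSecJ_expMem` + ★ `K2LiuArchJunctionFrameData.hsec_placeSec_relabel`, assembler's); hGgen's `V`-bookkeeping (assembler's).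
HONEST LABEL.  Count-neutral helper: `HC_CM` is proved only modulo the 7 printed citations (2 remaining named inputs: hLiu418 = `stmt-HodgeConjecture-24832`,
h413 = `stmt-HodgeConjecture-24833`) until rung 0 closes; this file closes no socket.

## References
* [Folland1989] G. B. Folland, *Harmonic Analysis in Phase Space* (1989), §4.2 (4.24), Prop. (4.39) (the infinitesimal Weil representation; `𝔭^±` act by `zz′`∕`∂∂′`).
* [KashiwaraVergne1978] M. Kashiwara, M. Vergne, Invent. Math. 44 (1978), §II.5.
* [Howe1989] R. Howe, *Transcending classical invariant theory*, J. AMS 2 (1989), §3 (polynomial × Gaussian is `(𝔤, K)`-stable).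
* [Varadarajan1984] V. S. Varadarajan, *Lie Groups, Lie Algebras, and Their Representations* (1984), Thm. 2.10.1 (one-parameter subgroups).
* [KonnoKonno2007] K. Konno, T. Konno, Kyushu J. Math. 61 (2007), §3.1, §3.3, Lemma 5.2.
-/

set_option autoImplicit false
set_option linter.dupNamespace false -- the mandated namespace repeats `HodgeConjecture.HodgeConjecture`

-- The Lie algebra `(uFormGroup (Fin 2) (Fin 2)).lie` of `U(2,2)` is typed over Mathlib's commutator bracket `LieRing.ofAssociativeRing` (a `def`, made a local
-- instance in ★ (G2-W1)∕(G2-W2)); here it is supplied INLINE by `letI` in each statement (★ `K2LiuArchSWSpanningStd` idiom), so the elaborated types are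
-- literally those of the ★ files and no instance attribute is declared.

noncomputable section

open scoped Matrix MatrixGroups SchwartzMap Real
open MvPolynomial Complex
open Literature.NumberTheory.Automorphic Literature.Analysis.SegalBargmann Literature.NumberTheory.Weil1964 Literature.NumberTheory.Weil1964.UnitaryWeil
open Literature.RepresentationTheory.KonnoKonno2007 Literature.RepresentationTheory.KonnoKonno2007.RealDualPair
open Literature.RepresentationTheory.KonnoKonno2007.RealDualPair.UForm
open Summit.HodgeConjecture.HodgeConjecture.Cruxes.HLiu418.K2LiuU22AdaptedBasis
open Summit.HodgeConjecture.HodgeConjecture.Cruxes.HLiu418.K2LiuFockPActionExport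

namespace Summit.HodgeConjecture.HodgeConjecture.Cruxes.HLiu418.K2LiuArchSWPlaceTransport

/-! ## §1 The two real one-parameter groups of a root: `exp (s Y_{pq}) = hypV p q s` and its `K`-conjugates -/

section OneParam

/-- **`exp (s · Y_{pq}) = hypV p q s` IN `U(2,2)`** (★ (G2-W1) `exp_smul_boostGen`, read on the regular group element `expMem`). [cite: Varadarajan1984, Thm. 2.10.1] -/
theorem expMem_smul_boostGen (p q : Fin 2) (s : ℝ) :
    letI : LieRing (Matrix (Fin 2 ⊕ Fin 2) (Fin 2 ⊕ Fin 2) ℂ) := LieRing.ofAssociativeRing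
    ((uFormGroup (Fin 2) (Fin 2)).expMem
        ⟨((s • (⟨boostGen p q, boostGen_mem_lie p q⟩ : ↥(uFormGroup (Fin 2) (Fin 2)).lie.toSubmodule) : ↥(uFormGroup (Fin 2) (Fin 2)).lie.toSubmodule) :
            Matrix (Fin 2 ⊕ Fin 2) (Fin 2 ⊕ Fin 2) ℂ),
          (s • (⟨boostGen p q, boostGen_mem_lie p q⟩ : ↥(uFormGroup (Fin 2) (Fin 2)).lie.toSubmodule)).2⟩ : UForm (Fin 2) (Fin 2)) =
      hypV p q s := by
  letI : LieRing (Matrix (Fin 2 ⊕ Fin 2) (Fin 2 ⊕ Fin 2) ℂ) := LieRing.ofAssociativeRing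
  refine Subtype.ext (Units.ext ?_)
  change NormedSpace.exp (((s • (⟨boostGen p q, boostGen_mem_lie p q⟩ : ↥(uFormGroup (Fin 2) (Fin 2)).lie.toSubmodule) :
      ↥(uFormGroup (Fin 2) (Fin 2)).lie.toSubmodule) : Matrix (Fin 2 ⊕ Fin 2) (Fin 2 ⊕ Fin 2) ℂ)) = _
  rw [Submodule.coe_smul]
  exact exp_smul_boostGen p q s

/-- **`exp (s · g Y_{pq} g⁻¹) = g · hypV p q s · g⁻¹` IN `U(2,2)`** for every `g ∈ U(2,2)` (`Ad`-equivariance of the exponential: Mathlib `Matrix.exp_units_conj`).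
[cite: Varadarajan1984, Thm. 2.10.1] -/
theorem expMem_smul_conj_boostGen (g : UForm (Fin 2) (Fin 2)) (p q : Fin 2) (s : ℝ) :
    letI : LieRing (Matrix (Fin 2 ⊕ Fin 2) (Fin 2 ⊕ Fin 2) ℂ) := LieRing.ofAssociativeRing
    ((uFormGroup (Fin 2) (Fin 2)).expMem
        ⟨((s • (⟨((g : GL (Fin 2 ⊕ Fin 2) ℂ) : Matrix (Fin 2 ⊕ Fin 2) (Fin 2 ⊕ Fin 2) ℂ) * boostGen p q *
                  (((g : GL (Fin 2 ⊕ Fin 2) ℂ)⁻¹ : GL (Fin 2 ⊕ Fin 2) ℂ) : Matrix (Fin 2 ⊕ Fin 2) (Fin 2 ⊕ Fin 2) ℂ),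
                (uFormGroup (Fin 2) (Fin 2)).conj_mem_lie _ g.2 _ (boostGen_mem_lie p q)⟩ : ↥(uFormGroup (Fin 2) (Fin 2)).lie.toSubmodule) :
              ↥(uFormGroup (Fin 2) (Fin 2)).lie.toSubmodule) : Matrix (Fin 2 ⊕ Fin 2) (Fin 2 ⊕ Fin 2) ℂ),
          (s • (⟨((g : GL (Fin 2 ⊕ Fin 2) ℂ) : Matrix (Fin 2 ⊕ Fin 2) (Fin 2 ⊕ Fin 2) ℂ) * boostGen p q *
                  (((g : GL (Fin 2 ⊕ Fin 2) ℂ)⁻¹ : GL (Fin 2 ⊕ Fin 2) ℂ) : Matrix (Fin 2 ⊕ Fin 2) (Fin 2 ⊕ Fin 2) ℂ),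
                (uFormGroup (Fin 2) (Fin 2)).conj_mem_lie _ g.2 _ (boostGen_mem_lie p q)⟩ : ↥(uFormGroup (Fin 2) (Fin 2)).lie.toSubmodule)).2⟩ :
          UForm (Fin 2) (Fin 2)) =
      g * hypV p q s * g⁻¹ := by
  letI : LieRing (Matrix (Fin 2 ⊕ Fin 2) (Fin 2 ⊕ Fin 2) ℂ) := LieRing.ofAssociativeRing
  refine Subtype.ext (Units.ext ?_)
  change NormedSpace.exp (((s • (⟨((g : GL (Fin 2 ⊕ Fin 2) ℂ) : Matrix (Fin 2 ⊕ Fin 2) (Fin 2 ⊕ Fin 2) ℂ) * boostGen p q *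
                  (((g : GL (Fin 2 ⊕ Fin 2) ℂ)⁻¹ : GL (Fin 2 ⊕ Fin 2) ℂ) : Matrix (Fin 2 ⊕ Fin 2) (Fin 2 ⊕ Fin 2) ℂ),
                (uFormGroup (Fin 2) (Fin 2)).conj_mem_lie _ g.2 _ (boostGen_mem_lie p q)⟩ : ↥(uFormGroup (Fin 2) (Fin 2)).lie.toSubmodule) :
      ↥(uFormGroup (Fin 2) (Fin 2)).lie.toSubmodule) : Matrix (Fin 2 ⊕ Fin 2) (Fin 2 ⊕ Fin 2) ℂ)) = _
  rw [Submodule.coe_smul, Submodule.coe_mk, ← Matrix.smul_mul, ← Matrix.mul_smul, Matrix.exp_units_conj, K2LiuU22AdaptedBasis.exp_smul_boostGen]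
  rfl

end OneParam

/-! ## §2 (T2-an) The two real letters as WEAK DERIVATIVE LETTERS of an archimedean Weil datum of `U(2,2) × U(R,S)` -/

section WeakLetters

variable {R S : Type*} [Fintype R] [DecidableEq R] [Fintype S] [DecidableEq S]
  {V : Type*} [NormedAddCommGroup V] [NormedSpace ℝ V]

/-- **THE BOOST LETTER (first real direction `X_v = Y_{pq}` of the root `(p,q)`).**  For every archimedean Weil datum `ω` of `U(2,2) × U(R,S)`, every
continuous real-linear `T : 𝓢 → V` and every `Φ ∈ 𝓢(ℝ^{DPIdx})`:
`HasDerivAt (s ↦ T (ω (exp (s Y_{pq}), 1) Φ)) (T (hypOpGenC p q Φ)) 0` — `ω (hypV p q s, 1) = hypOp p q s` (★ `weilDatum_apply_hypV_eq_hypOp`) and `hypOp` is a smooth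
one-parameter family of Schwartz operators with generator `hypOpGen` (★ `isSmoothOneParam_hypOp`). [cite: Folland1989, §4.2 (4.24), Prop. (4.39)] [cite: Varadarajan1984, Thm. 2.10.1] -/
theorem hasDerivAt_weilDatum_expMem_boost {ω : Representation ℂ (Ginf (Fin 2) (Fin 2) R S) (SchwartzMap (DPIdx (Fin 2) (Fin 2) R S → ℝ) ℂ)}
    (hW : IsArchWeilDatum (ι𝕎 (Fin 2) (Fin 2) R S) ω) (p q : Fin 2)
    (T : (SchwartzMap (DPIdx (Fin 2) (Fin 2) R S → ℝ) ℂ) →L[ℝ] V) (Φ : SchwartzMap (DPIdx (Fin 2) (Fin 2) R S → ℝ) ℂ) :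
    letI : LieRing (Matrix (Fin 2 ⊕ Fin 2) (Fin 2 ⊕ Fin 2) ℂ) := LieRing.ofAssociativeRing
    HasDerivAt (fun s : ℝ => T (ω ((((uFormGroup (Fin 2) (Fin 2)).expMem
        ⟨((s • (⟨boostGen p q, boostGen_mem_lie p q⟩ : ↥(uFormGroup (Fin 2) (Fin 2)).lie.toSubmodule) : ↥(uFormGroup (Fin 2) (Fin 2)).lie.toSubmodule) :
            Matrix (Fin 2 ⊕ Fin 2) (Fin 2 ⊕ Fin 2) ℂ),
          (s • (⟨boostGen p q, boostGen_mem_lie p q⟩ : ↥(uFormGroup (Fin 2) (Fin 2)).lie.toSubmodule)).2⟩ : UForm (Fin 2) (Fin 2)),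
        (1 : UForm R S)) : Ginf (Fin 2) (Fin 2) R S) Φ))
      (T (hypOpGenC R S p q Φ)) 0 := by
  letI : LieRing (Matrix (Fin 2 ⊕ Fin 2) (Fin 2 ⊕ Fin 2) ℂ) := LieRing.ofAssociativeRing
  have h := (isSmoothOneParam_hypOp R S p q).hasDerivAt_apply T Φ 0
  rw [hypOp_zero, ContinuousLinearMap.id_apply] at h
  refine h.congr_of_eventuallyEq (Filter.Eventually.of_forall fun s => ?_)
  show T (ω _ Φ) = T (hypOp R S p q s Φ)
  rw [expMem_smul_boostGen, weilDatum_apply_hypV_eq_hypOp hW]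

/-- **THE CONJUGATED BOOST LETTER (second real direction `X_{iv} = Ad(k_P(θ)) Y_{pq}`, any phase `θ`; `θ = π∕2` for the root vector).**  For every archimedean
Weil datum `ω` of `U(2,2) × U(R,S)`, along `Y := g Y_{pq} g⁻¹` with `g = (κ k_P(θ)).1 ∈ U(2) × U(2)` the phase element of ★ `phaseP`:
`HasDerivAt (s ↦ T (ω (exp (sY), 1) Φ)) (T (μ₀(D_θ) (hypOpGenC p q (μ₀(D_θ)⁻¹ Φ)))) 0`, `μ₀(D_θ) = unitaryOpPi (phaseU θ)` — i.e. the derivative vector is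
`rotBoostGen θ Φ` (★ `rotBoostGen_apply`): `exp (sY) = κ k_P(θ) · (hypV s, 1) · κ k_P(θ)⁻¹` (§1 + ★ `κ_mul_inl_mul_κ_inv`), `ω` of it is `rotBoostOp θ s`
(★ `weilDatum_apply_rotBoost`), and `hypOp` is smooth (★ `isSmoothOneParam_hypOp`) through the fixed continuous `T ∘ μ₀(D_θ)`.
[cite: Folland1989, §4.2 (4.24), Prop. (4.39)] [cite: Varadarajan1984, Thm. 2.10.1] -/
theorem hasDerivAt_weilDatum_expMem_conj_boost {ω : Representation ℂ (Ginf (Fin 2) (Fin 2) R S) (SchwartzMap (DPIdx (Fin 2) (Fin 2) R S → ℝ) ℂ)}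
    (hW : IsArchWeilDatum (ι𝕎 (Fin 2) (Fin 2) R S) ω) (p q : Fin 2) (θ : ℝ)
    (T : (SchwartzMap (DPIdx (Fin 2) (Fin 2) R S → ℝ) ℂ) →L[ℝ] V) (Φ : SchwartzMap (DPIdx (Fin 2) (Fin 2) R S → ℝ) ℂ) :
    letI : LieRing (Matrix (Fin 2 ⊕ Fin 2) (Fin 2 ⊕ Fin 2) ℂ) := LieRing.ofAssociativeRing
    HasDerivAt (fun s : ℝ => T (ω ((((uFormGroup (Fin 2) (Fin 2)).expMem
        ⟨((s • (⟨((UForm.kV (Fin 2) (Fin 2) (phaseP R S p θ).1 : GL (Fin 2 ⊕ Fin 2) ℂ) : Matrix (Fin 2 ⊕ Fin 2) (Fin 2 ⊕ Fin 2) ℂ) * boostGen p q *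
                  (((UForm.kV (Fin 2) (Fin 2) (phaseP R S p θ).1 : GL (Fin 2 ⊕ Fin 2) ℂ)⁻¹ : GL (Fin 2 ⊕ Fin 2) ℂ) : Matrix (Fin 2 ⊕ Fin 2) (Fin 2 ⊕ Fin 2) ℂ),
                (uFormGroup (Fin 2) (Fin 2)).conj_mem_lie _ (UForm.kV (Fin 2) (Fin 2) (phaseP R S p θ).1).2 _ (boostGen_mem_lie p q)⟩ :
                ↥(uFormGroup (Fin 2) (Fin 2)).lie.toSubmodule) : ↥(uFormGroup (Fin 2) (Fin 2)).lie.toSubmodule) : Matrix (Fin 2 ⊕ Fin 2) (Fin 2 ⊕ Fin 2) ℂ),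
          (s • (⟨((UForm.kV (Fin 2) (Fin 2) (phaseP R S p θ).1 : GL (Fin 2 ⊕ Fin 2) ℂ) : Matrix (Fin 2 ⊕ Fin 2) (Fin 2 ⊕ Fin 2) ℂ) * boostGen p q *
                  (((UForm.kV (Fin 2) (Fin 2) (phaseP R S p θ).1 : GL (Fin 2 ⊕ Fin 2) ℂ)⁻¹ : GL (Fin 2 ⊕ Fin 2) ℂ) : Matrix (Fin 2 ⊕ Fin 2) (Fin 2 ⊕ Fin 2) ℂ),
                (uFormGroup (Fin 2) (Fin 2)).conj_mem_lie _ (UForm.kV (Fin 2) (Fin 2) (phaseP R S p θ).1).2 _ (boostGen_mem_lie p q)⟩ :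
                ↥(uFormGroup (Fin 2) (Fin 2)).lie.toSubmodule)).2⟩ : UForm (Fin 2) (Fin 2)),
        (1 : UForm R S)) : Ginf (Fin 2) (Fin 2) R S) Φ))
      (T (unitaryOpPi (phaseU R S p θ) (hypOpGenC R S p q (unitaryOpPi (phaseU R S p θ)⁻¹ Φ)))) 0 := by
  letI : LieRing (Matrix (Fin 2 ⊕ Fin 2) (Fin 2 ⊕ Fin 2) ℂ) := LieRing.ofAssociativeRing
  have h := (isSmoothOneParam_hypOp R S p q).hasDerivAt_apply
    (T.comp ((unitaryOpPi (phaseU R S p θ) : (SchwartzMap (DPIdx (Fin 2) (Fin 2) R S → ℝ) ℂ) →L[ℂ]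
      SchwartzMap (DPIdx (Fin 2) (Fin 2) R S → ℝ) ℂ).restrictScalars ℝ)) (unitaryOpPi (phaseU R S p θ)⁻¹ Φ) 0
  rw [hypOp_zero, ContinuousLinearMap.id_apply] at h
  refine h.congr_of_eventuallyEq (Filter.Eventually.of_forall fun s => ?_)
  show T (ω _ Φ) = T (unitaryOpPi (phaseU R S p θ) (hypOp R S p q s (unitaryOpPi (phaseU R S p θ)⁻¹ Φ)))
  rw [expMem_smul_conj_boostGen, ← rotBoostOp_apply, ← weilDatum_apply_rotBoost R S p q hW θ s Φ, κ_mul_inl_mul_κ_inv]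

/-- **THE BOOST LETTER AT THE HYPOTHESIS-FREE JUNCTION DATUM `weilRep ∘ toBig` of `U(2,2) × U(R,S)`** (★ `isArchWeilDatum_weilRepPair`), in the LITERAL shape of the
sequel's weak derivative letter `hD` (test functionals `T : 𝓢 →L[ℝ] ℂ`). [cite: Folland1989, §4.2 (4.24), Prop. (4.39)] [cite: KonnoKonno2007, §3.3, Lemma 5.2] -/
theorem hasDerivAt_weilRepPair_expMem_boost (p q : Fin 2) (Φ : SchwartzMap (DPIdx (Fin 2) (Fin 2) R S → ℝ) ℂ)
    (T : (SchwartzMap (DPIdx (Fin 2) (Fin 2) R S → ℝ) ℂ) →L[ℝ] ℂ) :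
    letI : LieRing (Matrix (Fin 2 ⊕ Fin 2) (Fin 2 ⊕ Fin 2) ℂ) := LieRing.ofAssociativeRing
    HasDerivAt (fun s : ℝ => T (((weilRep (α := (Fin 2 × R) ⊕ (Fin 2 × S)) (β := (Fin 2 × S) ⊕ (Fin 2 × R))).comp (toBig (Fin 2) (Fin 2) R S))
      ((((uFormGroup (Fin 2) (Fin 2)).expMem
        ⟨((s • (⟨boostGen p q, boostGen_mem_lie p q⟩ : ↥(uFormGroup (Fin 2) (Fin 2)).lie.toSubmodule) : ↥(uFormGroup (Fin 2) (Fin 2)).lie.toSubmodule) :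
            Matrix (Fin 2 ⊕ Fin 2) (Fin 2 ⊕ Fin 2) ℂ),
          (s • (⟨boostGen p q, boostGen_mem_lie p q⟩ : ↥(uFormGroup (Fin 2) (Fin 2)).lie.toSubmodule)).2⟩ : UForm (Fin 2) (Fin 2)),
        (1 : UForm R S)) : Ginf (Fin 2) (Fin 2) R S) Φ))
      (T (hypOpGenC R S p q Φ)) 0 :=
  hasDerivAt_weilDatum_expMem_boost (isArchWeilDatum_weilRepPair (Fin 2) (Fin 2) R S) p q T Φ

/-- **THE CONJUGATED BOOST LETTER AT THE HYPOTHESIS-FREE JUNCTION DATUM**, in the literal `hD` shape. [cite: Folland1989, §4.2 (4.24), Prop. (4.39)]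
[cite: KonnoKonno2007, §3.3, Lemma 5.2] -/
theorem hasDerivAt_weilRepPair_expMem_conj_boost (p q : Fin 2) (θ : ℝ) (Φ : SchwartzMap (DPIdx (Fin 2) (Fin 2) R S → ℝ) ℂ)
    (T : (SchwartzMap (DPIdx (Fin 2) (Fin 2) R S → ℝ) ℂ) →L[ℝ] ℂ) :
    letI : LieRing (Matrix (Fin 2 ⊕ Fin 2) (Fin 2 ⊕ Fin 2) ℂ) := LieRing.ofAssociativeRing
    HasDerivAt (fun s : ℝ => T (((weilRep (α := (Fin 2 × R) ⊕ (Fin 2 × S)) (β := (Fin 2 × S) ⊕ (Fin 2 × R))).comp (toBig (Fin 2) (Fin 2) R S))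
      ((((uFormGroup (Fin 2) (Fin 2)).expMem
        ⟨((s • (⟨((UForm.kV (Fin 2) (Fin 2) (phaseP R S p θ).1 : GL (Fin 2 ⊕ Fin 2) ℂ) : Matrix (Fin 2 ⊕ Fin 2) (Fin 2 ⊕ Fin 2) ℂ) * boostGen p q *
                  (((UForm.kV (Fin 2) (Fin 2) (phaseP R S p θ).1 : GL (Fin 2 ⊕ Fin 2) ℂ)⁻¹ : GL (Fin 2 ⊕ Fin 2) ℂ) : Matrix (Fin 2 ⊕ Fin 2) (Fin 2 ⊕ Fin 2) ℂ),
                (uFormGroup (Fin 2) (Fin 2)).conj_mem_lie _ (UForm.kV (Fin 2) (Fin 2) (phaseP R S p θ).1).2 _ (boostGen_mem_lie p q)⟩ :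
                ↥(uFormGroup (Fin 2) (Fin 2)).lie.toSubmodule) : ↥(uFormGroup (Fin 2) (Fin 2)).lie.toSubmodule) : Matrix (Fin 2 ⊕ Fin 2) (Fin 2 ⊕ Fin 2) ℂ),
          (s • (⟨((UForm.kV (Fin 2) (Fin 2) (phaseP R S p θ).1 : GL (Fin 2 ⊕ Fin 2) ℂ) : Matrix (Fin 2 ⊕ Fin 2) (Fin 2 ⊕ Fin 2) ℂ) * boostGen p q *
                  (((UForm.kV (Fin 2) (Fin 2) (phaseP R S p θ).1 : GL (Fin 2 ⊕ Fin 2) ℂ)⁻¹ : GL (Fin 2 ⊕ Fin 2) ℂ) : Matrix (Fin 2 ⊕ Fin 2) (Fin 2 ⊕ Fin 2) ℂ),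
                (uFormGroup (Fin 2) (Fin 2)).conj_mem_lie _ (UForm.kV (Fin 2) (Fin 2) (phaseP R S p θ).1).2 _ (boostGen_mem_lie p q)⟩ :
                ↥(uFormGroup (Fin 2) (Fin 2)).lie.toSubmodule)).2⟩ : UForm (Fin 2) (Fin 2)),
        (1 : UForm R S)) : Ginf (Fin 2) (Fin 2) R S) Φ))
      (T (unitaryOpPi (phaseU R S p θ) (hypOpGenC R S p q (unitaryOpPi (phaseU R S p θ)⁻¹ Φ)))) 0 :=
  hasDerivAt_weilDatum_expMem_conj_boost (isArchWeilDatum_weilRepPair (Fin 2) (Fin 2) R S) p q θ T Φ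

end WeakLetters

/-! ## §3 (T2-alg) The Fock reading: the two letters on `B⁻¹F` are `B⁻¹G`'s, and their `𝔭^±` combinations are the (E-b) symbols `Ap ∕ Am` -/

section Fock

variable (R S : Type*) [Fintype R] [DecidableEq R] [Fintype S] [DecidableEq S] (p q : Fin 2)

/-- **the boost letter preserves polynomial × Gaussian data**: `hypOpGen p q (B⁻¹F) = B⁻¹G` for an EXPLICIT Fock polynomial `G` (★ `hypOpGen_binvPi`: the
`frameU`-conjugate of the diagonal quadratic symbol). [cite: Folland1989, Prop. (4.39)] [cite: Howe1989, §3] -/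
theorem exists_fock_hypOpGenC (F : MvPolynomial (DPIdx (Fin 2) (Fin 2) R S) ℂ) :
    ∃ G : MvPolynomial (DPIdx (Fin 2) (Fin 2) R S) ℂ, binvPi G = hypOpGenC R S p q (binvPi F) :=
  ⟨_, (hypOpGen_binvPi R S p q F).symm⟩

/-- **the conjugated boost letter preserves polynomial × Gaussian data**: `μ₀(D_θ) (hypOpGen p q (μ₀(D_θ)⁻¹ (B⁻¹F))) = B⁻¹G` for an EXPLICIT `G`
(★ `rotBoostGen_binvPi`: the pair symbol re-weighted by the phases `e^{±iθ}`). [cite: Folland1989, Prop. (4.39)] [cite: Howe1989, §3] -/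
theorem exists_fock_rotBoostGen (θ : ℝ) (F : MvPolynomial (DPIdx (Fin 2) (Fin 2) R S) ℂ) :
    ∃ G : MvPolynomial (DPIdx (Fin 2) (Fin 2) R S) ℂ,
      binvPi G = unitaryOpPi (phaseU R S p θ) (hypOpGenC R S p q (unitaryOpPi (phaseU R S p θ)⁻¹ (binvPi F))) := by
  refine ⟨_, ((rotBoostGen_binvPi R S p q θ F).symm.trans ?_).symm.symm⟩
  rw [rotBoostGen_apply, hypOpGenC_apply]

/-- **`Ap_{(p,q)} F = G₁ − i·G₂`** whenever `B⁻¹G₁ = hypOpGen p q (B⁻¹F)` and `B⁻¹G₂ = rotBoostGen (π∕2) (B⁻¹F)` (★ (E-b) `binvPi_ap` + ★ `binvPi_injective`); `Ap` is the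
★ (E-b) FILE 2 explicit term `(2π⁻¹i)·D^S_{pq} − (2πi)·(C^R_{pq}·)`. [cite: Folland1989, Prop. (4.39)] [cite: KashiwaraVergne1978, §II.5] -/
theorem ap_eq_of_binvPi_eq (F G₁ G₂ : MvPolynomial (DPIdx (Fin 2) (Fin 2) R S) ℂ)
    (hG₁ : binvPi G₁ = hypOpGenC R S p q (binvPi F))
    (hG₂ : binvPi G₂ = unitaryOpPi (phaseU R S p (π / 2)) (hypOpGenC R S p q (unitaryOpPi (phaseU R S p (π / 2))⁻¹ (binvPi F)))) :
    (((2 * (π : ℂ)⁻¹ * I : ℂ) • (∑ s : S, pderivLin (Sum.inr (Sum.inl (p, s)) : DPIdx (Fin 2) (Fin 2) R S) ∘ₗ pderivLin (Sum.inl (Sum.inr (q, s)))) -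
          (2 * π * I : ℂ) • LinearMap.mulLeft ℂ (∑ r : R, X (Sum.inl (Sum.inl (p, r))) * X (Sum.inr (Sum.inr (q, r))) : MvPolynomial (DPIdx (Fin 2) (Fin 2) R S) ℂ)) F) =
      G₁ - I • G₂ := by
  apply binvPi_injective
  have h := binvPi_ap R S (p, q) F
  simp only [binvPiₗ_apply] at h
  rw [h, binvPi_sub, binvPi_smul, hG₁, hG₂, ContinuousLinearMap.coe_coe, sub_apply, smul_apply, ContinuousLinearMap.comp_apply, ContinuousLinearMap.comp_apply]

/-- **`Am_{(p,q)} F = G₁ + i·G₂`** under the same two readings (★ (E-b) `binvPi_am`); `Am = (2πi)·(C^S_{pq}·) − (2π⁻¹i)·D^R_{pq}`.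
[cite: Folland1989, Prop. (4.39)] [cite: KashiwaraVergne1978, §II.5] -/
theorem am_eq_of_binvPi_eq (F G₁ G₂ : MvPolynomial (DPIdx (Fin 2) (Fin 2) R S) ℂ)
    (hG₁ : binvPi G₁ = hypOpGenC R S p q (binvPi F))
    (hG₂ : binvPi G₂ = unitaryOpPi (phaseU R S p (π / 2)) (hypOpGenC R S p q (unitaryOpPi (phaseU R S p (π / 2))⁻¹ (binvPi F)))) :
    (((2 * π * I : ℂ) • LinearMap.mulLeft ℂ (∑ s : S, X (Sum.inr (Sum.inl (p, s))) * X (Sum.inl (Sum.inr (q, s))) : MvPolynomial (DPIdx (Fin 2) (Fin 2) R S) ℂ) -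
          (2 * (π : ℂ)⁻¹ * I : ℂ) • ∑ r : R, pderivLin (Sum.inl (Sum.inl (p, r)) : DPIdx (Fin 2) (Fin 2) R S) ∘ₗ pderivLin (Sum.inr (Sum.inr (q, r)))) F) =
      G₁ + I • G₂ := by
  apply binvPi_injective
  have h := binvPi_am R S (p, q) F
  simp only [binvPiₗ_apply] at h
  rw [h, binvPi_add, binvPi_smul, hG₁, hG₂, ContinuousLinearMap.coe_coe, add_apply, smul_apply, ContinuousLinearMap.comp_apply, ContinuousLinearMap.comp_apply]

/-- **THE (deriv-closure) BOOKKEEPING `hAp_good ∕ hAm_good` OF ★ B3-core `forall_tuple_of_fockLetters`, from the two real derivative steps.**  For ANY property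
`Good₁` of Fock polynomials at the place (the consumer's `F ↦ Good (update rest σ F)`) closed under `+` and scalars: if along EACH of the two real letters of the root
`(p,q)` a derivative step holds in the shape hGgen's (deriv) clause produces — «`Good₁ (c • F + G)` for some scalar `c` (the `detChar` and `η_t` character legs) and
some `G` with `B⁻¹G` = the letter's derivative of `B⁻¹F`» — then `Good₁ F` implies `Good₁ (Ap_{(p,q)} F)` and `Good₁ (Am_{(p,q)} F)`:
`G = (c • F + G) + (−c) • F`, and `Ap F = G₁ − i·G₂`, `Am F = G₁ + i·G₂` (`ap_eq_of_binvPi_eq`, `am_eq_of_binvPi_eq`). [cite: Howe1989, §3] [cite: Folland1989, Prop. (4.39)] -/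
theorem good_ap_am_of_derivLetters {Good₁ : MvPolynomial (DPIdx (Fin 2) (Fin 2) R S) ℂ → Prop}
    (hadd : ∀ F G, Good₁ F → Good₁ G → Good₁ (F + G)) (hsmul : ∀ (c : ℂ) F, Good₁ F → Good₁ (c • F))
    (F : MvPolynomial (DPIdx (Fin 2) (Fin 2) R S) ℂ)
    (h₁ : ∃ (c : ℂ) (G : MvPolynomial (DPIdx (Fin 2) (Fin 2) R S) ℂ), binvPi G = hypOpGenC R S p q (binvPi F) ∧ Good₁ (c • F + G))
    (h₂ : ∃ (c : ℂ) (G : MvPolynomial (DPIdx (Fin 2) (Fin 2) R S) ℂ),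
      binvPi G = unitaryOpPi (phaseU R S p (π / 2)) (hypOpGenC R S p q (unitaryOpPi (phaseU R S p (π / 2))⁻¹ (binvPi F))) ∧ Good₁ (c • F + G))
    (hF : Good₁ F) :
    Good₁ (((2 * (π : ℂ)⁻¹ * I : ℂ) • (∑ s : S, pderivLin (Sum.inr (Sum.inl (p, s)) : DPIdx (Fin 2) (Fin 2) R S) ∘ₗ pderivLin (Sum.inl (Sum.inr (q, s)))) -
          (2 * π * I : ℂ) • LinearMap.mulLeft ℂ (∑ r : R, X (Sum.inl (Sum.inl (p, r))) * X (Sum.inr (Sum.inr (q, r))) : MvPolynomial (DPIdx (Fin 2) (Fin 2) R S) ℂ)) F) ∧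
      Good₁ (((2 * π * I : ℂ) • LinearMap.mulLeft ℂ (∑ s : S, X (Sum.inr (Sum.inl (p, s))) * X (Sum.inl (Sum.inr (q, s))) : MvPolynomial (DPIdx (Fin 2) (Fin 2) R S) ℂ) -
          (2 * (π : ℂ)⁻¹ * I : ℂ) • ∑ r : R, pderivLin (Sum.inl (Sum.inl (p, r)) : DPIdx (Fin 2) (Fin 2) R S) ∘ₗ pderivLin (Sum.inr (Sum.inr (q, r)))) F) := by
  obtain ⟨c₁, G₁, hG₁, hg₁⟩ := h₁
  obtain ⟨c₂, G₂, hG₂, hg₂⟩ := h₂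
  -- `G = (c • F + G) + (−c) • F`
  have hG₁' : Good₁ G₁ := by
    have h := hadd _ _ hg₁ (hsmul (-c₁) F hF)
    rwa [neg_smul, ← sub_eq_add_neg, add_sub_cancel_left] at h
  have hG₂' : Good₁ G₂ := by
    have h := hadd _ _ hg₂ (hsmul (-c₂) F hF)
    rwa [neg_smul, ← sub_eq_add_neg, add_sub_cancel_left] at h
  refine ⟨?_, ?_⟩
  · rw [ap_eq_of_binvPi_eq R S p q F G₁ G₂ hG₁ hG₂, sub_eq_add_neg, ← neg_smul]
    exact hadd _ _ hG₁' (hsmul _ _ hG₂')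
  · rw [am_eq_of_binvPi_eq R S p q F G₁ G₂ hG₁ hG₂]
    exact hadd _ _ hG₁' (hsmul _ _ hG₂')

end Fock

end Summit.HodgeConjecture.HodgeConjecture.Cruxes.HLiu418.K2LiuArchSWPlaceTransport

end
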